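import Summits.NavierStokesRegularity.NavierStokesRegularity.Theorems.SoloSalvageMagsanop2026Enstrophy
import Summits.NavierStokesRegularity.NavierStokesRegularity.Theorems.TypeICertificateLadderRungReynoldsOneTaoCover
import Summits.NavierStokesRegularity.NavierStokesRegularity.Theses.EfficiencyFloor
import Literature.Analysis.FluidPDE.BKMClassGradientContinuity
import Literature.Analysis.FluidPDE.BKMClassEnstrophyContinuity
import HarnessLib

/-!
# `EfficiencyFloor.EnstrophyBudget` (item stmt-NavierStokesRegularity-22995) — the enstrophy budget with
# the sharp-exponent stretching envelope, along a maximal smooth Leray–Hopf solution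

This is also the registered stub `stub_enstrophyBudget` of the BC3 skeleton of the crux
`EfficiencyFloor.ProductionEfficiencyDecay` (stmt-NavierStokesRegularity-22866); the two signatures are
identical.

**Statement (the route decl, verbatim).** There is a universal `c > 0` such that for every `ν, T > 0` and
every maximal smooth solution `(u,p)` of the unforced Navier–Stokes system on `ℝ³ × [0,T)`, Leray–Hopf from
its rapidly decaying datum, there are real functions `Z` (enstrophy `∫|curl u|²`), `Pal` (palinstrophy
`∫|∇ curl u|²_F`) and `S` (stretching `∫⟪ω, ∇u ω⟫`) with, at every `t ∈ (0,T)`: `∫⁻‖curl u(t)‖ₑ² = ofReal Z(t)`,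
`Z, Pal ≥ 0`, `dZ/dt = 2S − 2ν·Pal` (`HasDerivAt`) and `|S| ≤ c · Z^{3/4} · Pal^{3/4}`.

PROOF. (1) By the Tao-class cover of closed sub-slabs (`RungReynoldsOne.stub_taoCover`, Tao 2013 Cor. 11.1 in
the tree) the solution has all `L²` Sobolev norms bounded on every `[0,T'']`, `T'' < T`, i.e. it is a
Chae/BKM-class local solution (`Literature.Claims.NS.Chae2007.IsLocalSolution`). (2) Along such a solution the
classical enstrophy identity `d/dt ½∫|ω|² = ∫⟪ω,∇u ω⟫ − ν∫|∇ω|²_F` holds at interior times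
(`LucardoOlivaes2026.hasDerivAt_half_ensq`, Majda–Bertozzi §3.1.1). (3) The envelope: Cauchy–Schwarz
`|S| ≤ ‖ω‖²_{L⁴} ‖∇u‖_{L²}` (`Magsanop2026Enstrophy.abs_stretchI_le`), Ladyzhenskaya
`‖ω‖⁴_{L⁴} ≤ K³ ‖ω‖_{L²} ‖∇ω‖³_{L²}` (`Magsanop2026Enstrophy.integral_curl_pow_four_le`, `K` Mathlib's
Gagliardo–Nirenberg–Sobolev constant of `H¹(ℝ³) ⊂ L⁶`) and the div–curl identity `‖∇u‖_{L²} = ‖ω‖_{L²}`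
(`integral_frobeniusNormSq_fderiv_eq_integral_norm_curl_sq`) give `|S|² ≤ K³ Z^{3/2} Pal^{3/2}`, whence
`|S| ≤ (K³ + 1) Z^{3/4} Pal^{3/4}` (this is Robinson–Rodrigo–Sadowski 2016 (6.7) / Lu–Doering 2008 up to the
constant). So `c = K³ + 1`.

HONEST FRAMING: classical bookkeeping along a HYPOTHETICAL maximal solution of finite lifespan; nothing here
asserts that one exists, nothing about NS regularity or blow-up is claimed, and the crux
`ProductionEfficiencyDecay` is NOT proved by this file.

References: Majda–Bertozzi 2002 §3.1.1; Robinson–Rodrigo–Sadowski 2016 (6.7), Lemma 8.16; Lu–Doering 2008;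
Tao 2013 Cor. 11.1. [folklore]
-/

-- the problem directory repeats the summit name (`NavierStokesRegularity/NavierStokesRegularity`)
set_option linter.dupNamespace false

noncomputable section

open Set Filter MeasureTheory Topology InnerProductSpace
open scoped RealInnerProductSpace ENNReal NNReal ContDiff

namespace Summit.NavierStokesRegularity.NavierStokesRegularity.Theorems

namespace EnstrophyBudget

open Literature.Analysis.FluidPDE
open Literature.Claims.NS.Magsanop2026 (E3 vortSq gradSq)
open Literature.Claims.NS.LucardoOlivaes2026 (ensq stretchI)
open Literature.Claims.NS.Chae2007 (IsLocalSolution)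
open Summit.NavierStokesRegularity.NavierStokesRegularity.Theorems.RungReynoldsOne (stub_taoCover)
open Summit.NavierStokesRegularity.NavierStokesRegularity.Theorems.Magsanop2026Enstrophy
  (K6_nonneg abs_stretchI_le integral_curl_pow_four_le)
open Summit.NavierStokesRegularity.NavierStokesRegularity.Theorems.LucardoOlivaes2026 (hasDerivAt_half_ensq)

variable {ν T : ℝ} {u : ℝ → E3 → E3} {p : ℝ → E3 → ℝ}

/-- **A classical Leray–Hopf rapidly-decaying-datum solution on `[0,T)` is a Chae/BKM-class local solution**:
all `L²` Sobolev norms of `u` are bounded on every `[0,T'']`, `T'' < T` (Tao 2013, Cor. 11.1, through the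
tree's `RungReynoldsOne.stub_taoCover`). [cite: Tao2011, Cor. 11.1] -/
theorem isLocalSolution (hν : 0 < ν) (hT : 0 < T) (hsol : IsClassicalNSSolutionOn (Ico 0 T) ν 0 u p)
    (hLH : IsLerayHopfOn T ν 0 (u 0) u) (hdec : HasRapidSpatialDecay (u 0)) :
    IsLocalSolution ν T (u 0) u p where
  isClassical := hsol
  initial := rfl
  sobolev := by
    intro T'' hT''
    have hT' : max T'' (T / 2) ∈ Ioo 0 T :=
      ⟨lt_max_of_lt_right (half_pos hT), max_lt hT'' (half_lt_self hT)⟩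
    obtain ⟨q, -, hB, -, -⟩ := stub_taoCover hν hT hsol hLH hdec hT'
    exact hB.mono (Icc_subset_Icc_right (le_max_left _ _))

/-- All Sobolev seminorms of a slice `u t`, `0 ≤ t < T`, are finite. [cite: Tao2011, Cor. 11.1] -/
theorem sobolev_slice (h : IsLocalSolution ν T (u 0) u p) {t : ℝ} (ht : t ∈ Ico 0 T) (n : ℕ) :
    ∫⁻ x, ‖iteratedFDeriv ℝ n (u t) x‖ₑ ^ 2 < ⊤ := by
  obtain ⟨C, hC⟩ := h.sobolev t ht.2 n
  exact (hC t ⟨ht.1, le_rfl⟩).trans_lt ENNReal.coe_lt_top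

/-- **The sharp-exponent stretching envelope** `|∫⟪ω,∇v ω⟫| ≤ (K³+1) (∫|ω|²)^{3/4} (∫|∇ω|²_F)^{3/4}` for a
smooth divergence-free `v` with `v, Dv, D²v ∈ L²` (`K` = Mathlib's Gagliardo–Nirenberg–Sobolev constant of
`H¹(ℝ³) ⊂ L⁶`): Cauchy–Schwarz, Ladyzhenskaya's `L⁴` inequality for `ω`, and `‖∇v‖_{L²} = ‖ω‖_{L²}`.
[cite: RobinsonRodrigoSadowski2016, (6.7)] -/
theorem abs_stretchI_le_rpow {v : E3 → E3} (hv : ContDiff ℝ 3 v) (hdiv : VectorCalculus.IsDivFree v)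
    (h0 : ∫⁻ x, ‖v x‖ₑ ^ 2 < ⊤) (h1 : ∫⁻ x, ‖iteratedFDeriv ℝ 1 v x‖ₑ ^ 2 < ⊤)
    (h2 : ∫⁻ x, ‖iteratedFDeriv ℝ 2 v x‖ₑ ^ 2 < ⊤) :
    |stretchI v| ≤ ((SNormLESNormFDerivOfEqConst E3 (volume : Measure E3) 2 : ℝ) ^ 3 + 1) *
      (∫ x, ‖curl v x‖ ^ 2) ^ (3 / 4 : ℝ) *
        (∫ x, frobeniusNormSq (fderiv ℝ (curl v) x)) ^ (3 / 4 : ℝ) := by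
  set K : ℝ := (SNormLESNormFDerivOfEqConst E3 (volume : Measure E3) 2 : ℝ) with hK
  set V : ℝ := ∫ x, ‖curl v x‖ ^ 2 with hV
  set P : ℝ := ∫ x, frobeniusNormSq (fderiv ℝ (curl v) x) with hP
  have hK0 : 0 ≤ K := K6_nonneg
  have hV0 : 0 ≤ V := integral_nonneg fun x => by positivity
  have hP0 : 0 ≤ P := integral_nonneg fun x => frobeniusNormSq_nonneg _
  -- Cauchy–Schwarz and Ladyzhenskaya
  have hS := abs_stretchI_le hv h1 h2
  have hL := integral_curl_pow_four_le hv h1 h2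
  -- `∫|∇v|²_F = ∫|ω|²`
  have hG : gradSq v = V :=
    integral_frobeniusNormSq_fderiv_eq_integral_norm_curl_sq (hv.of_le (by norm_cast)) hdiv h0 h1 h2
  have hvort : vortSq v = V := rfl
  have hgrad : gradSq (curl v) = P := rfl
  rw [hG] at hS
  rw [hvort, hgrad] at hL
  have h40 : 0 ≤ ∫ x, ‖curl v x‖ ^ 4 := integral_nonneg fun x => by positivity
  -- square both sides
  have hb0 : 0 ≤ (K ^ 3 + 1) * V ^ (3 / 4 : ℝ) * P ^ (3 / 4 : ℝ) := by positivity
  rw [← sq_le_sq₀ (abs_nonneg _) hb0]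
  have hsq : |stretchI v| ^ 2 ≤ (∫ x, ‖curl v x‖ ^ 4) * V := by
    calc |stretchI v| ^ 2 ≤ (Real.sqrt (∫ x, ‖curl v x‖ ^ 4) * Real.sqrt V) ^ 2 :=
          pow_le_pow_left₀ (abs_nonneg _) hS 2
      _ = (∫ x, ‖curl v x‖ ^ 4) * V := by
          rw [mul_pow, Real.sq_sqrt h40, Real.sq_sqrt hV0]
  have hVV : Real.sqrt V * V = V ^ (3 / 2 : ℝ) := by
    rw [Real.sqrt_eq_rpow, ← Real.rpow_add_one' hV0 (by norm_num)]
    norm_num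
  have h34 : ∀ {y : ℝ}, 0 ≤ y → (y ^ (3 / 4 : ℝ)) ^ 2 = y ^ (3 / 2 : ℝ) := fun {y} hy => by
    rw [← Real.rpow_natCast, ← Real.rpow_mul hy]
    norm_num
  calc |stretchI v| ^ 2 ≤ (∫ x, ‖curl v x‖ ^ 4) * V := hsq
    _ ≤ K ^ 3 * Real.sqrt V * P ^ (3 / 2 : ℝ) * V := mul_le_mul_of_nonneg_right hL hV0
    _ = K ^ 3 * (V ^ (3 / 2 : ℝ) * P ^ (3 / 2 : ℝ)) := by rw [← hVV]; ring
    _ ≤ (K ^ 3 + 1) ^ 2 * (V ^ (3 / 2 : ℝ) * P ^ (3 / 2 : ℝ)) := by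
        apply mul_le_mul_of_nonneg_right _ (by positivity)
        nlinarith [pow_nonneg hK0 3, sq_nonneg (K ^ 3)]
    _ = ((K ^ 3 + 1) * V ^ (3 / 4 : ℝ) * P ^ (3 / 4 : ℝ)) ^ 2 := by
        rw [mul_pow, mul_pow, h34 hV0, h34 hP0]; ring

/-- **The enstrophy budget** (the item's content, with `c = K³ + 1`): along a maximal smooth Leray–Hopf
rapidly-decaying-datum solution, `Z(t) = ∫|curl u(t)|²`, `Pal(t) = ∫|∇curl u(t)|²_F`, `S(t) = ∫⟪ω,∇u ω⟫`
satisfy `dZ/dt = 2S − 2ν·Pal` and `|S| ≤ c Z^{3/4} Pal^{3/4}` at every `t ∈ (0,T)`.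
[cite: RobinsonRodrigoSadowski2016, (6.7)] -/
theorem main :
    ∃ c : ℝ, 0 < c ∧ ∀ (ν T : ℝ), 0 < ν → 0 < T →
      ∀ (u : ℝ → EuclideanSpace ℝ (Fin 3) → EuclideanSpace ℝ (Fin 3))
        (p : ℝ → EuclideanSpace ℝ (Fin 3) → ℝ),
        IsMaximalSmoothSolution ν 0 u p T → IsLerayHopfOn T ν 0 (u 0) u →
        HasRapidSpatialDecay (u 0) →
        ∃ (Zr Pr Sr : ℝ → ℝ), ∀ t ∈ Set.Ioo 0 T,
          ∫⁻ x, ‖curl (u t) x‖ₑ ^ 2 = ENNReal.ofReal (Zr t) ∧ 0 ≤ Zr t ∧ 0 ≤ Pr t ∧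
          Pr t = ∫ x, frobeniusNormSq (fderiv ℝ (curl (u t)) x) ∧
          Sr t = ∫ x, ⟪curl (u t) x, fderiv ℝ (u t) x (curl (u t) x)⟫_ℝ ∧
          HasDerivAt Zr (2 * Sr t - 2 * ν * Pr t) t ∧
          |Sr t| ≤ c * Zr t ^ (3 / 4 : ℝ) * Pr t ^ (3 / 4 : ℝ) := by
  refine ⟨(SNormLESNormFDerivOfEqConst E3 (volume : Measure E3) 2 : ℝ) ^ 3 + 1,
    by positivity, ?_⟩
  intro ν T hν hT u p hmax hLH hdec
  have hLS := isLocalSolution hν hT hmax.isClassicalNSSolutionOn hLH hdec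
  refine ⟨fun t => ∫ x, ‖curl (u t) x‖ ^ 2, fun t => ∫ x, frobeniusNormSq (fderiv ℝ (curl (u t)) x),
    fun t => stretchI (u t), ?_⟩
  intro t ht
  have htI : t ∈ Ico 0 T := ⟨ht.1.le, ht.2⟩
  have hsm : ContDiff ℝ ∞ (u t) := hmax.isClassicalNSSolutionOn.contDiff_velocity htI
  have hn : ∀ n : ℕ, ∫⁻ x, ‖iteratedFDeriv ℝ n (u t) x‖ₑ ^ 2 < ⊤ := sobolev_slice hLS htI
  have h0 : ∫⁻ x, ‖u t x‖ₑ ^ 2 < ⊤ := by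
    refine lt_of_le_of_lt (le_of_eq (lintegral_congr fun x => ?_)) (hn 0)
    rw [← ofReal_norm, ← ofReal_norm, norm_iteratedFDeriv_zero]
  refine ⟨lintegral_enorm_curl_sq_eq_ofReal_integral (hsm.of_le (by norm_cast)) (hn 1),
    integral_nonneg fun x => by positivity, integral_nonneg fun x => frobeniusNormSq_nonneg _, rfl, rfl,
    ?_, ?_⟩
  · -- the enstrophy identity, doubled
    have hD := (hasDerivAt_half_ensq hν hLS ht).const_mul 2
    have hfun : (fun s => 2 * ((1 / 2 : ℝ) * ensq u s)) = fun s => ∫ x, ‖curl (u s) x‖ ^ 2 := by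
      funext s
      simp only [ensq]
      ring
    rw [hfun] at hD
    refine hD.congr_deriv ?_
    simp only [stretchI]
    ring
  · exact abs_stretchI_le_rpow (hsm.of_le (by norm_cast)) (hmax.isClassicalNSSolutionOn.divFree t htI)
      h0 (hn 1) (hn 2)

end EnstrophyBudget

/-- **Item stmt-NavierStokesRegularity-22995** (`EfficiencyFloor.EnstrophyBudget`; = registered stub
`stub_enstrophyBudget` of the crux skeleton of `ProductionEfficiencyDecay`, stmt-22866): the enstrophy budget
`dZ/dt = 2S − 2ν·Pal` with the envelope `|S| ≤ c Z^{3/4} Pal^{3/4}` along every maximal smooth Leray–Hopf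
rapidly-decaying-datum solution. Bookkeeping about a hypothetical blow-up solution; nothing about NS
regularity is asserted and the crux is not proved here. [cite: RobinsonRodrigoSadowski2016, (6.7)] -/
theorem efficiencyFloor_enstrophyBudget_proof :
    Summit.NavierStokesRegularity.NavierStokesRegularity.Theses.EfficiencyFloor.EnstrophyBudget := by
  unfold Summit.NavierStokesRegularity.NavierStokesRegularity.Theses.EfficiencyFloor.EnstrophyBudget
  exact EnstrophyBudget.main

end Summit.NavierStokesRegularity.NavierStokesRegularity.Theorems

end
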